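import Mathlib
import HarnessLib
import Literature.AlgebraicGeometry.Resolution.RegularCentreLocal
import Summits.ResolutionOfSingularities.ResolutionOfSingularities.Theorems.WildQuotientsWildQuotientResolutionS1KillExitDefsTame
import Summits.ResolutionOfSingularities.ResolutionOfSingularities.Theorems.WildQuotientsWildQuotientResolutionS1aGradedLocalization

/-!
# S1a — TAME ROOT CHARTS LOCALISE: `A` a tame root chart ⇒ `A[a⁻¹]` a tame root chart

[OURS · L1 W4.5c · lead-1 g7; (T2e) consumer chain, «goodness is an open condition» for `GModel.IsGoodAt`] — NOT statements of the
manuscript; counted 0; AI-level work, weaker than expert review. Crux stmt-ResolutionOfSingularities-17941, line `s1a-logminvertex` v6.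

If `A ≅ B₀` for a regular Noetherian `Π ZMod`-graded `B` with units (T1) and finite generation (T2), then for `a : A` the ring `A[a⁻¹]`
is `≅ (B[a⁻¹])₀` with `B[a⁻¹]` graded by `GradedLocalization.locPiece` at the degree-`0` element `a` (`…S1aGradedLocalization`):
* `algebraMap_mem_locPiece_zero`, `invSelf_mem_locPiece_zero` — degree-`0` bookkeeping at a degree-`0` element;
* **`IsTameRootChart.away`** — `IsTameRootChart A → IsTameRootChart (Localization.Away a)`.
-/

set_option linter.dupNamespace false

noncomputable section

open DirectSum Literature.AlgebraicGeometry.Resolution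
open Summit.ResolutionOfSingularities.ResolutionOfSingularities.Theorems.WildQuotientResolution.S1.GradedLocalization

namespace Summit.ResolutionOfSingularities.ResolutionOfSingularities.Theorems.WildQuotientResolution.S1

universe u v

section Away

variable {ι : Type v} [AddCommGroup ι] [DecidableEq ι] {B : Type u} [CommRing B] (𝒜 : ι → AddSubgroup B) [GradedRing 𝒜]
  {h : B} (hh : h ∈ 𝒜 0)

/-- At a degree-`0` element, `x/1` has the degree of `x`. -/
theorem mk_mem_locPiece_of_deg_zero (m : ℕ) {e : ι} {x : B} (hx : x ∈ 𝒜 e) :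
    algebraMap B (Localization.Away h) x * IsLocalization.Away.invSelf h ^ m ∈ locPiece 𝒜 hh e :=
  mk_mem_locPiece 𝒜 hh m (by rwa [nsmul_zero, add_zero])

/-- At a degree-`0` element, `h⁻¹` has degree `0`. -/
theorem invSelf_mem_locPiece_zero : IsLocalization.Away.invSelf h ∈ locPiece 𝒜 hh 0 := by
  have := invSelf_mem_locPiece 𝒜 hh
  rwa [neg_zero] at this

/-- At a degree-`0` element, the degree-`e` piece of `B[h⁻¹]` consists of the `x / hᵐ`, `x ∈ 𝒜 e`. -/
theorem mem_locPiece_zero_iff {e : ι} {y : Localization.Away h} :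
    y ∈ locPiece 𝒜 hh e ↔ ∃ (m : ℕ) (x : B), x ∈ 𝒜 e ∧ y = algebraMap B (Localization.Away h) x * IsLocalization.Away.invSelf h ^ m := by
  rw [mem_locPiece_iff]
  simp only [nsmul_zero, add_zero]

end Away

/-- **Tame root charts localise.** [OURS · L1 W4.5c] -/
theorem IsTameRootChart.away {A : Type u} [CommRing A] (hA : IsTameRootChart A) (a : A) :
    IsTameRootChart (Localization.Away a) := by
  classical
  obtain ⟨m, r, B, _, 𝒜, _, hN, hR, ⟨s, hs, hfin⟩, ⟨t, ht⟩, ⟨e⟩⟩ := hA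
  haveI := hN
  haveI := hR
  -- the degree-0 element `h = e a` and the graded localisation `B[h⁻¹]`
  have hh : ((e a : ↥(𝒜 0)) : B) ∈ 𝒜 0 := (e a).2
  letI := locGradedRing 𝒜 hh
  refine ⟨m, r, Localization.Away ((e a : ↥(𝒜 0)) : B), inferInstance, locPiece 𝒜 hh, inferInstance,
    IsLocalization.isNoetherianRing (Submonoid.powers ((e a : ↥(𝒜 0)) : B)) _ hN,
    isRegularRing_of_isLocalization (Submonoid.powers ((e a : ↥(𝒜 0)) : B)) _, ?_, ?_, ⟨?_⟩⟩
  · -- (T1): the same units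
    refine ⟨s, fun d hd => ?_, hfin⟩
    obtain ⟨u, hu, hud⟩ := hs d hd
    exact ⟨algebraMap B _ u, hu.map _, algebraMap_mem_locPiece 𝒜 hh hud⟩
  · -- (T2): the images of `t` (the inverse `h⁻¹` is of degree `0`)
    let t' : Finset (Localization.Away ((e a : ↥(𝒜 0)) : B)) := t.image (algebraMap B (Localization.Away ((e a : ↥(𝒜 0)) : B)))
    refine ⟨t', ?_⟩
    rw [eq_top_iff]
    rintro y -
    obtain ⟨x, n, rfl⟩ := exists_eq_algebraMap_mul_invSelf_pow (h := ((e a : ↥(𝒜 0)) : B)) y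
    have hinv : IsLocalization.Away.invSelf ((e a : ↥(𝒜 0)) : B) ∈
        Subring.closure (((locPiece 𝒜 hh 0 : AddSubgroup (Localization.Away ((e a : ↥(𝒜 0)) : B))) : Set (Localization.Away ((e a : ↥(𝒜 0)) : B))) ∪ (↑t' : Set (Localization.Away ((e a : ↥(𝒜 0)) : B)))) := by
      apply Subring.subset_closure
      exact Or.inl (invSelf_mem_locPiece_zero 𝒜 hh)
    have hx : x ∈ Subring.closure (((𝒜 0 : AddSubgroup B) : Set B) ∪ ↑t) := by rw [ht]; trivial
    have hmap : (Subring.closure (((𝒜 0 : AddSubgroup B) : Set B) ∪ ↑t)).map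
        (algebraMap B (Localization.Away ((e a : ↥(𝒜 0)) : B))) ≤
        Subring.closure (((locPiece 𝒜 hh 0 : AddSubgroup (Localization.Away ((e a : ↥(𝒜 0)) : B))) : Set (Localization.Away ((e a : ↥(𝒜 0)) : B))) ∪ (↑t' : Set (Localization.Away ((e a : ↥(𝒜 0)) : B)))) := by
      rw [RingHom.map_closure, Subring.closure_le]
      rintro _ ⟨z, hz | hz, rfl⟩
      · apply Subring.subset_closure
        exact Or.inl (algebraMap_mem_locPiece 𝒜 hh hz)
      · apply Subring.subset_closure
        exact Or.inr (Finset.mem_coe.mpr (Finset.mem_image_of_mem _ (Finset.mem_coe.mp hz)))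
    exact mul_mem (hmap ⟨x, hx, rfl⟩) (pow_mem hinv n)
  · -- `A[a⁻¹] ≃ (B[h⁻¹])₀`
    -- the map `A[a⁻¹] → B[h⁻¹]`
    let g : A →+* Localization.Away ((e a : ↥(𝒜 0)) : B) :=
      (algebraMap B _).comp ((SetLike.GradeZero.subring 𝒜).subtype.comp (e : A →+* ↥(𝒜 0)))
    have hg : ∀ x : A, g x = algebraMap B _ ((e x : ↥(𝒜 0)) : B) := fun x => by
      simp only [g, RingHom.coe_comp, Function.comp_apply]
      rfl
    have hunit : IsUnit (g a) := by rw [hg]; exact IsLocalization.Away.algebraMap_isUnit _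
    let φ : Localization.Away a →+* Localization.Away ((e a : ↥(𝒜 0)) : B) := IsLocalization.Away.lift a hunit
    have hφ : ∀ (x : A) (n : ℕ), φ (algebraMap A _ x * IsLocalization.Away.invSelf a ^ n) =
        algebraMap B _ ((e x : ↥(𝒜 0)) : B) * IsLocalization.Away.invSelf ((e a : ↥(𝒜 0)) : B) ^ n := by
      intro x n
      have h1 : φ (algebraMap A _ x) = algebraMap B _ ((e x : ↥(𝒜 0)) : B) := by
        rw [← hg x]; exact IsLocalization.Away.lift_eq a hunit x
      have h2 : φ (IsLocalization.Away.invSelf a) = IsLocalization.Away.invSelf ((e a : ↥(𝒜 0)) : B) := by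
        have ha : φ (algebraMap A _ a) * φ (IsLocalization.Away.invSelf a) = 1 := by
          rw [← map_mul, IsLocalization.Away.mul_invSelf, map_one]
        rw [IsLocalization.Away.lift_eq] at ha
        change g a * _ = 1 at ha
        rw [hg] at ha
        have hb : algebraMap B (Localization.Away ((e a : ↥(𝒜 0)) : B)) ((e a : ↥(𝒜 0)) : B) *
            IsLocalization.Away.invSelf ((e a : ↥(𝒜 0)) : B) = 1 := IsLocalization.Away.mul_invSelf _
        exact (IsLocalization.Away.algebraMap_isUnit ((e a : ↥(𝒜 0)) : B)).mul_left_cancel (ha.trans hb.symm)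
      rw [map_mul, map_pow, h1, h2]
    -- range `= (B[h⁻¹])₀`
    have hrange : ∀ y, φ y ∈ locPiece 𝒜 hh 0 := by
      intro y
      obtain ⟨x, n, rfl⟩ := exists_eq_algebraMap_mul_invSelf_pow (h := a) y
      rw [hφ]
      exact mk_mem_locPiece_of_deg_zero 𝒜 hh n (e x).2
    refine RingEquiv.ofBijective (φ.codRestrict (SetLike.GradeZero.subring (locPiece 𝒜 hh)) hrange) ⟨?_, ?_⟩
    · -- injective
      rw [injective_iff_map_eq_zero]
      intro y hy
      have hy' : φ y = 0 := congrArg Subtype.val hy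
      obtain ⟨x, n, rfl⟩ := exists_eq_algebraMap_mul_invSelf_pow (h := a) y
      rw [hφ] at hy'
      have hunit' : IsUnit (IsLocalization.Away.invSelf ((e a : ↥(𝒜 0)) : B) ^ n) :=
        (IsUnit.of_mul_eq_one_right _ (IsLocalization.Away.mul_invSelf (S := Localization.Away ((e a : ↥(𝒜 0)) : B))
          ((e a : ↥(𝒜 0)) : B))).pow n
      have h0 : algebraMap B (Localization.Away ((e a : ↥(𝒜 0)) : B)) ((e x : ↥(𝒜 0)) : B) = 0 :=
        (hunit'.mul_left_eq_zero).mp hy'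
      obtain ⟨⟨_, N, rfl⟩, hN⟩ := (IsLocalization.map_eq_zero_iff (Submonoid.powers ((e a : ↥(𝒜 0)) : B))
        (Localization.Away ((e a : ↥(𝒜 0)) : B)) _).mp h0
      -- `h^N · e x = 0` in `B`, hence `a^N x = 0` in `A`
      have hA : a ^ N * x = 0 := by
        apply e.injective
        apply Subtype.ext
        rw [map_mul, map_pow, map_zero]
        exact hN
      have : algebraMap A (Localization.Away a) x = 0 :=
        (IsLocalization.map_eq_zero_iff (Submonoid.powers a) _ _).mpr ⟨⟨_, N, rfl⟩, hA⟩
      rw [this, zero_mul]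
    · -- surjective
      rintro ⟨y, hy⟩
      obtain ⟨n, x, hx, rfl⟩ := (mem_locPiece_zero_iff 𝒜 hh).mp hy
      refine ⟨algebraMap A _ (e.symm ⟨x, hx⟩) * IsLocalization.Away.invSelf a ^ n, Subtype.ext ?_⟩
      change φ _ = _
      rw [hφ, e.apply_symm_apply]

end Summit.ResolutionOfSingularities.ResolutionOfSingularities.Theorems.WildQuotientResolution.S1

end
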